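import Summits.AtomisticToContinuum.HydrodynamicLimit.Theorems.MourreKoopmanChargesLinearToEntropyInBandLedgerGlue
import Summits.AtomisticToContinuum.HydrodynamicLimit.Theorems.MourreKoopmanChargesLinearToEntropyInBandContinuityOfEnvelopePrep
import Summits.AtomisticToContinuum.HydrodynamicLimit.Theses.BGEndpointRigidity
import HarnessLib

/-!
# Crux `MourreKoopmanCharges.LinearToEntropyInBand` (stmt-AtomisticToContinuum-17740), line `registered`:
# wave-3 consolidation — the guarded window continuity from `LanfordEnvelopeR` (stmt-13677)

Helper file (`--supports stmt-AtomisticToContinuum-17740`).  In skeleton v5 the by-name input stub 4b,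
`TwoClocks.TransferActivityTails` (stmt-16624, OPEN), is consumed only through the guarded window continuity
`|H_N(s') − H_N(s)| ≤ (N+1) ε` over micro windows (`LTEInBand.glue_windowContinuityInBandBelow_of_tails`, landed
p154880, via CAT 13734 ∧ CEAT), and there the two activity-tail inputs are used at ONE level only.  This file
proves the guarded window continuity — and hence the v4 stub 4 — from the Lanford pair envelope of the TRUE law
(`BGEndpointRigidity.LanfordEnvelopeR`, stmt-13677, the head stub 3 hinges on since p155741) plus the guarded
cubic tails `EnergyCurrentTailsBelow η`, so that skeleton v6 may replace stub 4b by `stub_lanfordEnvelopeR`: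

* `glue_windowContinuityInBandBelow_of_lanfordEnvelopeR` (registered glue):
  `LanfordEnvelopeR → EnergyCurrentTailsBelow η → WindowContinuityInBandBelow η` — the proof of
  `glue_windowContinuityInBandBelow_of_tails` with the two activity-tail hypotheses of
  `HydroLimitInBandContinuity.abs_klDiv_window_sub_le` supplied at level `V = 0` by the Prep file's
  `glue_activityTailZero_of_pairEnvelope`: the pair conjunct of
  `CollisionRate.stub_marginalEnvelopeLG_of_lanfordEnvelopeR` on the horizon `[0, t + τ]`, the marks `‖v − w‖`
  and `‖v − w‖ (‖v‖ + ‖w‖)` (Prep §1) integrated by the landed Gaussian flux moments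
  `mmr_lintegral_norm_sub_sq_prod_gaussMeasure_le`, `mmr_lintegral_energyMark_prod_gaussMeasure_le`, the rates
  `κ = (4 C τ σ² J + 1)⁻¹` by the normalisation `(N+1)² ε_N² τ ν_N = σ² τ (N+1)`, then the bookkeeping
  `(N+1) ν_N · const ≤ (N+1) ε`, `ν_N = (N+1)^{-1/3} → 0`;
* `glue_ballwiseLedger_of_static_of_lanfordEnvelopeR` (registered glue): the composition through the landed
  guarded summation `glue_ledgerOfStaticAndContinuityBelow`, i.e. `4a → LanfordEnvelopeR → (v4 stub 4)`.

Nothing here restates the crux, the route's items or the Statement; `LanfordEnvelopeR` and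
`EnergyCurrentTailsBelow η` enter only as hypotheses.  References: H.-T. Yau, Lett. Math. Phys. 22 (1991) §2;
S. Olla, S. R. S. Varadhan, H.-T. Yau, Comm. Math. Phys. 155 (1993) §3; C. Cercignani, R. Illner,
M. Pulvirenti, *The Mathematical Theory of Dilute Gases* (1994) App. 4.A.
-/

noncomputable section

open MeasureTheory Filter Set Topology InformationTheory
open scoped ENNReal InnerProductSpace BigOperators

namespace Summit.AtomisticToContinuum.HydrodynamicLimit.Theorems.LTEInBand

open Literature.MathematicalPhysics.KineticTheory Literature.Analysis.FluidPDE
open Literature.Analysis.FunctionSpaces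
open Summit.AtomisticToContinuum.HydrodynamicLimit.Theses
open Summit.AtomisticToContinuum.HydrodynamicLimit.Theorems
  (lintegral_meanVelObs_localGibbsMeasure_le lintegral_norm_sq_gaussMeasure)
open Summit.AtomisticToContinuum.HydrodynamicLimit.Theorems.ClampedCurrentsDockFromWindows
  (LedgerIntegratedCoreInBand OneWindowLedgerStatic)
open Summit.AtomisticToContinuum.HydrodynamicLimit.Theorems.HydroLimitInBandContinuity
  (abs_klDiv_window_sub_le exists_abs_DgExp_one_le exists_lipschitz_slab isSmoothSpaceTimeOn_momPart
    isSmoothSpaceTimeOn_inv)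
open Summit.AtomisticToContinuum.HydrodynamicLimit.Theorems.RestartPrinciple.AgeDuhamelForgetting
  (mmr_lintegral_energyMark_prod_gaussMeasure_le mmr_lintegral_norm_sub_sq_prod_gaussMeasure_le)

/-! ## The registered glue: guarded window continuity from the Lanford envelope -/

/-- **Registered glue `glue_windowContinuityInBandBelow_of_lanfordEnvelopeR` (wave 3).** The Lanford pair
envelope of the true law (`BGEndpointRigidity.LanfordEnvelopeR`, stmt-13677) and the GUARDED cubic tails
`EnergyCurrentTailsBelow η` give the guarded window continuity `WindowContinuityInBandBelow η` of
`glue_ledgerOfStaticAndContinuityBelow`: the proof of `glue_windowContinuityInBandBelow_of_tails` with the two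
activity-tail inputs of `HydroLimitInBandContinuity.abs_klDiv_window_sub_le` supplied at level `V = 0` by
`glue_activityTailZero_of_pairEnvelope` (Prep) — pair conjunct of `CollisionRate.stub_marginalEnvelopeLG_of_lanfordEnvelopeR`
on the horizon `[0, t + τ]`, marks `‖v − w‖` / `‖v − w‖ (‖v‖ + ‖w‖)` (Prep §1) with the landed Gaussian flux moments
`mmr_lintegral_norm_sub_sq_prod_gaussMeasure_le` / `mmr_lintegral_energyMark_prod_gaussMeasure_le`, rates
`κ = (4 C τ σ² J + 1)⁻¹` by the normalisation `(N+1)² ε_N² τ ν_N = σ² τ (N+1)` — then the bookkeeping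
`(N+1) ν_N · const ≤ (N+1) ε`, `ν_N = (N+1)^{-1/3} → 0`. [cite: Yau1991, §2] -/
theorem glue_windowContinuityInBandBelow_of_lanfordEnvelopeR : ∀ η : ℝ, 0 < η → Summit.AtomisticToContinuum.HydrodynamicLimit.Theses.BGEndpointRigidity.LanfordEnvelopeR → Summit.AtomisticToContinuum.HydrodynamicLimit.Theorems.LTEInBand.EnergyCurrentTailsBelow η → ∀ (r : ℝ) (Rf : ℝ → ℝ), 0 < r → (∀ x ∈ Set.Icc 0 r, 1 ≤ Rf x ∧ Rf x ≤ 2) → (∃ L : NNReal, LipschitzOnWith L Rf (Set.Icc 0 r)) → ∀ (a₀ θ₀ : Literature.MathematicalPhysics.KineticTheory.T3 → ℝ) (u₀ : Literature.MathematicalPhysics.KineticTheory.T3 → Literature.MathematicalPhysics.KineticTheory.V3), Continuous a₀ → Continuous θ₀ → Continuous u₀ → (∀ x, 0 < a₀ x) → (∀ x, 0 < θ₀ x) → ∃ σ₀ : ℝ, 0 < σ₀ ∧ ∀ σ : ℝ, 0 < σ → σ < σ₀ → ∀ (T : ℝ) (ρ θ : ℝ → Literature.MathematicalPhysics.KineticTheory.T3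 → ℝ) (u : ℝ → Literature.MathematicalPhysics.KineticTheory.T3 → Literature.MathematicalPhysics.KineticTheory.V3), Literature.MathematicalPhysics.KineticTheory.IsHardSphereEulerSolution σ T ρ u θ → (∀ s ∈ Set.Ico 0 T, ∀ x, ρ s x * σ ^ 3 < η) → ∀ Φ : (N : ℕ) → Literature.Analysis.FluidPDE.HardSphereFlow (Literature.Analysis.FluidPDE.Torus.geometry (Fin 3)) (Literature.MathematicalPhysics.KineticTheory.hsDiameter σ N) (N + 1), Literature.MathematicalPhysics.KineticTheory.TendstoHydroFieldsAt (fun N => Literature.MathematicalPhysics.KineticTheory.localGibbsLaw σ a₀ u₀ θ₀ N (Φ N)) Φ ρ u θ 0 → ∀ t ∈ Set.Ioo 0 T, (∀ s ∈ Set.Icc 0 t, ∀ x, ρ s x * σ ^ 3 < r) → ∀ τ : ℝ, 0 < τ → ∀ ε : ℝ, 0 < ε → ∃ N₀ : ℕ, ∀ N : ℕ, N₀ ≤ N → ∀ s ∈ Set.Icc 0 t, ∀ s' ∈ Set.Icc 0 t, s ≤ s' → s' ≤ s + τ * ((N : ℝ) + 1) ^ (-(1 / 3 : ℝ)) → |(InformationTheory.klDiv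 ((Φ N).lawAt (Literature.MathematicalPhysics.KineticTheory.localGibbsLaw σ a₀ u₀ θ₀ N (Φ N)) s') (Literature.MathematicalPhysics.KineticTheory.localGibbsLaw σ (fun x => ρ s' x * Rf (σ ^ 3 * ρ s' x)) (u s') (θ s') N (Φ N))).toReal - (InformationTheory.klDiv ((Φ N).lawAt (Literature.MathematicalPhysics.KineticTheory.localGibbsLaw σ a₀ u₀ θ₀ N (Φ N)) s) (Literature.MathematicalPhysics.KineticTheory.localGibbsLaw σ (fun x => ρ s x * Rf (σ ^ 3 * ρ s x)) (u s) (θ s) N (Φ N))).toReal| ≤ ((N : ℝ) + 1) * ε := by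
  intro η _ hLan hECT r Rf hr hRf hRfL a₀ θ₀ u₀ ha hθ hu ha0 hθ0
  obtain ⟨σ₁, hσ₁, h1⟩ :=
    CollisionRate.stub_marginalEnvelopeLG_of_lanfordEnvelopeR hLan a₀ θ₀ u₀ ha hθ hu ha0 hθ0
  obtain ⟨σ₃, hσ₃, h3⟩ := hECT a₀ θ₀ u₀ ha hθ hu ha0 hθ0
  refine ⟨min σ₁ (min σ₃ (1 / 2)), lt_min hσ₁ (lt_min hσ₃ one_half_pos),
    fun σ hσ hσlt T ρ θ u hE hguard Φ hlim t ht hpack τ hτ ε hε => ?_⟩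
  have hσ1 : σ < σ₁ := hσlt.trans_le (min_le_left _ _)
  have hσ3 : σ < σ₃ := hσlt.trans_le ((min_le_right _ _).trans (min_le_left _ _))
  have hσhalf : σ < 1 / 2 := hσlt.trans_le ((min_le_right _ _).trans (min_le_right _ _))
  have ht0T : t ∈ Ico 0 T := ⟨ht.1.le, ht.2⟩
  have htT : Icc 0 t ⊆ Ico 0 T := Icc_subset_Ico_right ht.2
  -- the pair envelope of the true law on the horizon `[0, t + τ]`; the guarded cubic tails at ONE level
  obtain ⟨Ce, hCe, u', θ', hθ', N₁, hN₁⟩ := h1 σ hσ hσ1 Φ (t + τ) (by linarith [ht.1])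
  obtain ⟨M, N₃, hN₃⟩ := h3 σ hσ hσ3 T ρ θ u hE hguard Φ hlim t ht0T 1 one_pos
  -- the Gaussian flux bounds of the two marks and the normalising rates
  set J₁ : ℝ := 4 * (3 * θ' + ‖u'‖ ^ 2) with hJ₁
  set J₂ : ℝ := 8 * (1 + 8 * (‖u'‖ ^ 4 + 15 * θ' ^ 2)) with hJ₂
  have hJ₁0 : 0 ≤ J₁ := by positivity
  have hJ₂0 : 0 ≤ J₂ := by positivity
  set κ₁ : ℝ := (4 * Ce * τ * σ ^ 2 * J₁ + 1)⁻¹ with hκ₁def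
  set κ₂ : ℝ := (4 * Ce * τ * σ ^ 2 * J₂ + 1)⁻¹ with hκ₂def
  have hκ₁ : 0 < κ₁ := by positivity
  have hκ₂ : 0 < κ₂ := by positivity
  -- slab constants of the Euler solution
  obtain ⟨K, hK0, hK⟩ :=
    exists_abs_DgExp_one_le hE.smooth_temperature hE.smooth_velocity hE.temperature_pos ht.2
  choose Lb hLb0 hLb using fun j : Fin 3 => exists_lipschitz_slab
    (isSmoothSpaceTimeOn_momPart hE.smooth_temperature hE.smooth_velocity hE.temperature_pos j) ht.1 ht.2
  obtain ⟨Lγ, hLγ0, hLγ⟩ := exists_lipschitz_slab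
    (isSmoothSpaceTimeOn_inv hE.smooth_temperature hE.temperature_pos) ht.1 ht.2
  have hSL0 : 0 ≤ ∑ j, Lb j := Finset.sum_nonneg fun j _ => hLb0 j
  set L : ℝ := ∑ j, Lb j + Lγ with hLdef
  have hL0 : 0 ≤ L := by positivity
  have hd0 : ∀ x x' : T3, 0 ≤ Torus.euclidDist x x' := fun x x' => by
    rw [Torus.euclidDist_eq]; exact norm_nonneg _
  have hβ : ∀ r' ∈ Icc 0 t, ∀ (x x' : T3) (j : Fin 3),
      |u r' x j / θ r' x - u r' x' j / θ r' x'| ≤ L * Torus.euclidDist x x' := by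
    intro r' hr' x x' j
    have h := hLb j r' hr' r' hr' x x'
    rw [sub_self, abs_zero, zero_add, Real.norm_eq_abs] at h
    refine h.trans (mul_le_mul_of_nonneg_right ?_ (hd0 x x'))
    have := Finset.single_le_sum (fun j _ => hLb0 j) (Finset.mem_univ j)
    rw [hLdef]
    linarith
  have hγ : ∀ r' ∈ Icc 0 t, ∀ x x' : T3, |(θ r' x)⁻¹ - (θ r' x')⁻¹| ≤ L * Torus.euclidDist x x' := by
    intro r' hr' x x'
    have h := hLγ r' hr' r' hr' x x'
    rw [sub_self, abs_zero, zero_add, Real.norm_eq_abs] at h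
    refine h.trans (mul_le_mul_of_nonneg_right ?_ (hd0 x x'))
    rw [hLdef]
    linarith
  obtain ⟨Kρ, hKρ0, hKρ⟩ := exists_lipschitz_slab hE.smooth_density ht.1 ht.2
  -- a positive lower bound on the density over the slab
  obtain ⟨Ki, hKi⟩ := (isSmoothSpaceTimeOn_inv hE.smooth_density hE.density_pos).exists_norm_le_of_isCompact
    isCompact_Icc htT
  have hm : ∀ s₁ ∈ Icc 0 t, ∀ x, (|Ki| + 1)⁻¹ ≤ ρ s₁ x := by
    intro s₁ hs₁ x
    have hρ := hE.density_pos s₁ (htT hs₁) x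
    have h := hKi s₁ hs₁ x
    rw [Real.norm_eq_abs] at h
    rw [inv_le_comm₀ (by positivity) hρ]
    linarith [le_abs_self (ρ s₁ x)⁻¹, le_abs_self Ki]
  -- the Lipschitz constant of the insertion factor
  obtain ⟨LR, hLR⟩ := hRfL
  -- the second moment of the velocities at time zero
  obtain ⟨U, -, hU⟩ := exists_forall_abs_le_of_continuous (χ := fun x => ‖u₀ x‖) hu.norm
  obtain ⟨Θ, -, hΘ⟩ := exists_forall_abs_le_of_continuous hθ
  have hΘ0 : 0 ≤ Θ := (abs_nonneg _).trans (hΘ 0)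
  have hCKE0 : 0 ≤ U ^ 2 + 3 * Θ := by positivity
  have hKE : ∀ N, ∫⁻ z, ENNReal.ofReal (((N : ℝ) + 1)⁻¹ * ∑ i, ‖(z i).2‖ ^ 2)
      ∂(localGibbsLaw σ a₀ u₀ θ₀ N (Φ N)) ≤ ENNReal.ofReal (U ^ 2 + 3 * Θ) := by
    intro N
    rw [localGibbsLaw_eq]
    refine lintegral_meanVelObs_localGibbsMeasure_le ha hθ hu (fun x => (ha0 x).le) hθ0
      (f := fun v : V3 => ‖v‖ ^ 2) (by fun_prop) (fun v => sq_nonneg _) (fun y => ?_) σ N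
    rw [lintegral_norm_sq_gaussMeasure (u₀ y) (hθ0 y)]
    have h1 : ‖u₀ y‖ ≤ U := by simpa only [abs_of_nonneg (norm_nonneg _)] using hU y
    exact ENNReal.ofReal_le_ofReal (by
      nlinarith [(le_abs_self _).trans (hΘ y), pow_le_pow_left₀ (norm_nonneg _) h1 2])
  -- the total constant and the threshold in `N`
  set A₁ : ℝ := K * (2 + max M 0 * (U ^ 2 + 3 * Θ)) +
    (((|Ki| + 1)⁻¹)⁻¹ + LR * σ ^ 3) * Kρ * (3 + (U ^ 2 + 3 * Θ)) / 2 +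
    (((|Ki| + 1)⁻¹)⁻¹ + LR * σ ^ 3) * Kρ with hA₁
  have hA₁0 : 0 ≤ A₁ := by positivity
  set Ktot : ℝ := τ * A₁ + 4 * L * σ * (κ₁⁻¹ + κ₂⁻¹) + 1 with hKtot
  have hKtot0 : 0 < Ktot := by positivity
  have hν : Tendsto (fun N : ℕ => ((N : ℝ) + 1) ^ (-(1 / 3 : ℝ))) atTop (𝓝 0) :=
    (tendsto_rpow_neg_atTop (by norm_num : (0 : ℝ) < 1 / 3)).comp
      (tendsto_atTop_add_const_right _ 1 tendsto_natCast_atTop_atTop)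
  obtain ⟨N₄, hN₄⟩ := eventually_atTop.1 (hν.eventually_lt_const (div_pos hε hKtot0))
  refine ⟨max N₁ (max N₃ N₄), fun N hN s hs s' hs' hss' hs'le => ?_⟩
  have hN1 : N₁ ≤ N := (le_max_left _ _).trans hN
  have hN3 : N₃ ≤ N := ((le_max_left _ _).trans (le_max_right _ _)).trans hN
  have hN4 : N₄ ≤ N := ((le_max_right _ _).trans (le_max_right _ _)).trans hN
  have hN0 : (0 : ℝ) < (N : ℝ) + 1 := by positivity
  set ν : ℝ := ((N : ℝ) + 1) ^ (-(1 / 3 : ℝ)) with hνdef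
  have hν0 : 0 < ν := Real.rpow_pos_of_pos hN0 _
  have hν1 : ν ≤ 1 := Real.rpow_le_one_of_one_le_of_nonpos (by linarith) (by norm_num)
  have hνle : ν ≤ ε / Ktot := (hN₄ N hN4).le
  have hτν : 0 < τ * ν := mul_pos hτ hν0
  have hτν' : τ * ν ≤ τ := mul_le_of_le_one_right hτ.le hν1
  have hεN : hsDiameter σ N = σ * ν := by
    rw [hνdef, hsDiameter]
    push_cast
    ring
  -- the true law is carried by the good set; its pair envelope at the times of every micro window
  have hPgood : localGibbsLaw σ a₀ u₀ θ₀ N (Φ N) (Φ N).goodᶜ = 0 := by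
    rw [localGibbsLaw_eq]
    exact localGibbsMeasure_absolutelyContinuous σ _ _ _ N (Φ N) (Φ N).measure_compl_good
  have henv : ∀ s₁ ∈ Icc 0 t, ∀ r' ∈ Icc s₁ (s₁ + τ * ν), ∀ i j : Fin (N + 1), i ≠ j →
      ∀ f : (T3 × V3) × (T3 × V3) → ℝ≥0∞, Measurable f →
      ∫⁻ z, f ((Φ N).flow r' z i, (Φ N).flow r' z j) ∂(localGibbsLaw σ a₀ u₀ θ₀ N (Φ N)) ≤
        ENNReal.ofReal Ce * ∫⁻ q, f q ∂(((volume : Measure T3).prod (gaussMeasure u' θ')).prod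
          ((volume : Measure T3).prod (gaussMeasure u' θ'))) :=
    fun s₁ hs₁ r' hr' i j hij f hf =>
      (hN₁ N hN1 r' ⟨hs₁.1.trans hr'.1, hr'.2.trans (add_le_add hs₁.2 hτν')⟩).1 i j hij f hf
  -- the normalisation `(τ ν_N) (N+1)² ε_N² = τ σ² (N+1)` and the rates
  have hnorm : τ * ν * ((N + 1 : ℕ) : ℝ) ^ 2 * hsDiameter σ N ^ 2 = τ * σ ^ 2 * ((N : ℝ) + 1) := by
    have hν3 : ν ^ 3 = ((N : ℝ) + 1)⁻¹ := by
      rw [hνdef, ← Real.rpow_natCast, ← Real.rpow_mul hN0.le,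
        show (-(1 / 3 : ℝ)) * ((3 : ℕ) : ℝ) = -1 by norm_num, Real.rpow_neg_one]
    have hcast : ((N + 1 : ℕ) : ℝ) = (N : ℝ) + 1 := by push_cast; ring
    rw [hεN, hcast, show τ * ν * ((N : ℝ) + 1) ^ 2 * (σ * ν) ^ 2 = τ * σ ^ 2 * ((N : ℝ) + 1) ^ 2 * ν ^ 3 by ring,
      hν3]
    field_simp
  have hκle : ∀ {J : ℝ}, 0 ≤ J → (4 * Ce * τ * σ ^ 2 * J + 1)⁻¹ *
      (4 * Ce * (τ * ν) * ((N + 1 : ℕ) : ℝ) ^ 2 * hsDiameter σ N ^ 2 * J) ≤ (N : ℝ) + 1 := by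
    intro J hJ
    have heq : 4 * Ce * (τ * ν) * ((N + 1 : ℕ) : ℝ) ^ 2 * hsDiameter σ N ^ 2 * J =
        4 * Ce * τ * σ ^ 2 * J * ((N : ℝ) + 1) := by
      calc 4 * Ce * (τ * ν) * ((N + 1 : ℕ) : ℝ) ^ 2 * hsDiameter σ N ^ 2 * J
          = 4 * Ce * J * (τ * ν * ((N + 1 : ℕ) : ℝ) ^ 2 * hsDiameter σ N ^ 2) := by ring
        _ = 4 * Ce * τ * σ ^ 2 * J * ((N : ℝ) + 1) := by rw [hnorm]; ring
    rw [heq, ← mul_assoc]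
    refine mul_le_of_le_one_left hN0.le ?_
    rw [inv_mul_le_iff₀ (by positivity)]
    linarith
  -- the one-window estimate at this `N`, both activity inputs at level `0`
  have hmain := abs_klDiv_window_sub_le hσ hσhalf ha hθ hu ha0 hθ0 hE ht hRf hLR hpack N (Φ N) hK0 hK hL0 hβ hγ
    hKρ0 hKρ (m := (|Ki| + 1)⁻¹) (by positivity) hm hCKE0 (hKE N) (M := M)
    (fun r' hr' => hN₃ N hN3 r' hr') (V₁ := 0) le_rfl (κ₁ := κ₁) (w₁ := τ * ν) hκ₁
    (fun s₁ hs₁ => glue_activityTailZero_of_pairEnvelope hσ (Φ N) _ hPgood hτν hCe (gaussMeasure u' θ')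
      (henv s₁ hs₁) (g := fun c => ‖c.postVel.1 - c.preVel.1‖) (fun c => norm_nonneg _)
      (b := fun p => ‖p.1 - p.2‖) (by fun_prop) (fun p => norm_nonneg _)
      (fun y t' k l hkl => norm_ofConfig_postVel_sub_preVel_le _ _ y t' hkl)
      (mmr_lintegral_norm_sub_sq_prod_gaussMeasure_le u' hθ') hκ₁.le (hκle hJ₁0))
    (V₂ := 0) le_rfl (κ₂ := κ₂) (w₂ := τ * ν) hκ₂
    (fun s₁ hs₁ => glue_activityTailZero_of_pairEnvelope hσ (Φ N) _ hPgood hτν hCe (gaussMeasure u' θ')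
      (henv s₁ hs₁) (g := fun c => |‖c.postVel.1‖ ^ 2 - ‖c.preVel.1‖ ^ 2| / 2) (fun c => by positivity)
      (b := fun p => ‖p.1 - p.2‖ * (‖p.1‖ + ‖p.2‖)) (by fun_prop) (fun p => by positivity)
      (fun y t' k l hkl => abs_energyJump_ofConfig_le _ _ y t' hkl)
      (mmr_lintegral_energyMark_prod_gaussMeasure_le u' hθ') hκ₂.le (hκle hJ₂0))
    hs hs' hss' hs'le hs'le
  refine hmain.trans ?_
  -- bookkeeping: everything is `(N+1) ν_N · const`
  have hss : s' - s ≤ τ * ν := by linarith [hs'le]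
  have step1 : (s' - s) * (((N : ℝ) + 1) * A₁) ≤ τ * ν * (((N : ℝ) + 1) * A₁) :=
    mul_le_mul_of_nonneg_right hss (by positivity)
  have step2 : 4 * L * hsDiameter σ N * (((N : ℝ) + 1) * (κ₁⁻¹ * (0 + 1) + κ₂⁻¹ * (0 + 1))) =
      ν * ((N : ℝ) + 1) * (4 * L * σ * (κ₁⁻¹ + κ₂⁻¹)) := by
    rw [hεN]
    ring
  have hνK : ν * Ktot ≤ ε := by rwa [← le_div_iff₀ hKtot0]
  calc (s' - s) * (((N : ℝ) + 1) * A₁) + 4 * L * hsDiameter σ N *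
        (((N : ℝ) + 1) * (κ₁⁻¹ * (0 + 1) + κ₂⁻¹ * (0 + 1)))
      ≤ τ * ν * (((N : ℝ) + 1) * A₁) + ν * ((N : ℝ) + 1) * (4 * L * σ * (κ₁⁻¹ + κ₂⁻¹)) := by
        rw [step2]
        linarith [step1]
    _ = ((N : ℝ) + 1) * (ν * (Ktot - 1)) := by
        rw [hKtot]
        ring
    _ ≤ ((N : ℝ) + 1) * (ν * Ktot) :=
        mul_le_mul_of_nonneg_left (mul_le_mul_of_nonneg_left (by linarith) hν0.le) hN0.le
    _ ≤ ((N : ℝ) + 1) * ε := mul_le_mul_of_nonneg_left hνK hN0.le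

/-- **Registered glue `glue_ballwiseLedger_of_static_of_lanfordEnvelopeR` (wave 3): the v4 stub 4 from the
reshaped stub 4a and the Lanford envelope**, the cubic-tail input staying GUARDED.  For `η > 0`: 4a gives the
static one-window ledger; `LanfordEnvelopeR` and the stub's own antecedent `EnergyCurrentTailsBelow η` give
`WindowContinuityInBandBelow η` (`glue_windowContinuityInBandBelow_of_lanfordEnvelopeR`); the guarded summation
`glue_ledgerOfStaticAndContinuityBelow` concludes.  Replaces `glue_ballwiseLedger_of_static_of_activityTails`
(stub 4b by name) by stub 3's head (stmt-13677). -/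
theorem glue_ballwiseLedger_of_static_of_lanfordEnvelopeR : (∀ η : ℝ, 0 < η → Summit.AtomisticToContinuum.HydrodynamicLimit.Theorems.LTEInBand.VisibleFluxGibbsianity → Summit.AtomisticToContinuum.HydrodynamicLimit.Theorems.LTEInBand.EnergyCurrentTailsBelow η → Summit.AtomisticToContinuum.HydrodynamicLimit.Theorems.LTEInBand.FastCollisionThroughputBelow η → Summit.AtomisticToContinuum.HydrodynamicLimit.Theorems.ClampedCurrentsDockFromWindows.OneWindowLedgerStatic) → Summit.AtomisticToContinuum.HydrodynamicLimit.Theses.BGEndpointRigidity.LanfordEnvelopeR → (∀ η : ℝ, 0 < η → Summit.AtomisticToContinuum.HydrodynamicLimit.Theorems.LTEInBand.VisibleFluxGibbsianity → Summit.AtomisticToContinuum.HydrodynamicLimit.Theorems.LTEInBand.EnergyCurrentTailsBelow η → Summit.AtomisticToContinuum.HydrodynamicLimit.Theorems.LTEInBand.FastCollisionThroughputBelow η → Summit.AtomisticToContinuum.HydrodynamicLimit.Theorems.ClampedCurrentsDockFromWindows.LedgerIntegratedCoreInBand) :=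
  fun hS hLan η hη hV hT hF => glue_ledgerOfStaticAndContinuityBelow hη (hS η hη hV hT hF)
    (glue_windowContinuityInBandBelow_of_lanfordEnvelopeR η hη hLan hT)

end Summit.AtomisticToContinuum.HydrodynamicLimit.Theorems.LTEInBand

end
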